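import Mathlib

/-!
# Linear stability of the positive pattern: no eigenvalue with nonnegative real part

Finite-dimensional kernel of solo-blind paper §24.17(7)(k′).  At a positive solution `A` of the reduced
pattern equation the linearisation is `L = -H - 2·diag(A)·T·diag(A)` where `H ⪰ 0` is the Schrödinger
operator whose ground state is `A` (so `vᵀHv = 0` only on `ℝA`) and `T` has positive semidefinite
symmetric part.  Then `vᵀLv ≤ 0` with equality only on `ℝA`, and since `LA ∉ ℝA` every (complex)
eigenvalue of `L` has negative real part.  We phrase complex eigenpairs in real form
`Lx = αx - βy`, `Ly = βx + αy` and prove `α < 0`.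
-/

namespace Summit.AnomalousDissipation.AnomalousDissipation.Theorems

open Matrix

variable {ι : Type*} [Fintype ι]

/-- **Abstract form.** If the quadratic form of a real matrix `L` is nonpositive, vanishes only on the
line `ℝA`, and `LA ∉ ℝA`, then every eigenvalue `α + iβ` of `L` (written in real form on the pair
`x + iy ≠ 0`) has `α < 0`. -/
theorem eigen_re_neg_of_form_nonpos (L : Matrix ι ι ℝ) (A : ι → ℝ)
    (hL : ∀ v, v ⬝ᵥ (L *ᵥ v) ≤ 0) (hker : ∀ v, v ⬝ᵥ (L *ᵥ v) = 0 → ∃ c : ℝ, v = c • A)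
    (hLA : ∀ c : ℝ, L *ᵥ A ≠ c • A) (x y : ι → ℝ) (α β : ℝ)
    (hx : L *ᵥ x = α • x - β • y) (hy : L *ᵥ y = β • x + α • y) (hne : x ≠ 0 ∨ y ≠ 0) :
    α < 0 := by
  have ex : x ⬝ᵥ (L *ᵥ x) = α * (x ⬝ᵥ x) - β * (x ⬝ᵥ y) := by
    rw [hx, dotProduct_sub, dotProduct_smul, dotProduct_smul]; rfl
  have ey : y ⬝ᵥ (L *ᵥ y) = β * (x ⬝ᵥ y) + α * (y ⬝ᵥ y) := by
    rw [hy, dotProduct_add, dotProduct_smul, dotProduct_smul, dotProduct_comm y x]; rfl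
  have hsum : x ⬝ᵥ (L *ᵥ x) + y ⬝ᵥ (L *ᵥ y) = α * (x ⬝ᵥ x + y ⬝ᵥ y) := by
    rw [ex, ey]; ring
  have hxx : 0 ≤ x ⬝ᵥ x := by
    unfold dotProduct; exact Finset.sum_nonneg fun i _ => mul_self_nonneg (x i)
  have hyy : 0 ≤ y ⬝ᵥ y := by
    unfold dotProduct; exact Finset.sum_nonneg fun i _ => mul_self_nonneg (y i)
  have hpos : 0 < x ⬝ᵥ x + y ⬝ᵥ y := by
    rcases hne with h | h
    · have : x ⬝ᵥ x ≠ 0 := fun h0 => h (dotProduct_self_eq_zero.mp h0)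
      have : 0 < x ⬝ᵥ x := lt_of_le_of_ne hxx (Ne.symm this)
      linarith
    · have : y ⬝ᵥ y ≠ 0 := fun h0 => h (dotProduct_self_eq_zero.mp h0)
      have : 0 < y ⬝ᵥ y := lt_of_le_of_ne hyy (Ne.symm this)
      linarith
  have hαle : α ≤ 0 := by
    have h1 := hL x; have h2 := hL y
    have : α * (x ⬝ᵥ x + y ⬝ᵥ y) ≤ 0 := by rw [← hsum]; linarith
    by_contra hα
    have : 0 < α * (x ⬝ᵥ x + y ⬝ᵥ y) := mul_pos (lt_of_not_ge hα) hpos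
    linarith
  rcases lt_or_eq_of_le hαle with hlt | heq
  · exact hlt
  · exfalso
    subst heq
    have h1 := hL x; have h2 := hL y
    have hs0 : x ⬝ᵥ (L *ᵥ x) + y ⬝ᵥ (L *ᵥ y) = 0 := by rw [hsum]; ring
    have hx0 : x ⬝ᵥ (L *ᵥ x) = 0 := by linarith
    have hy0 : y ⬝ᵥ (L *ᵥ y) = 0 := by linarith
    obtain ⟨c, hc⟩ := hker x hx0
    obtain ⟨d, hd⟩ := hker y hy0
    by_cases hc0 : c = 0
    · subst hc0
      have hxz : x = 0 := by rw [hc]; simp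
      have hyne : y ≠ 0 := by
        rcases hne with h | h
        · exact absurd hxz h
        · exact h
      have hd0 : d ≠ 0 := by
        intro hd0; apply hyne; rw [hd, hd0]; simp
      have hLy : L *ᵥ y = 0 := by rw [hy, hxz]; simp
      have : L *ᵥ A = (0 : ℝ) • A := by
        have h' : d • (L *ᵥ A) = 0 := by rw [← mulVec_smul, ← hd]; exact hLy
        rw [zero_smul]
        exact (smul_eq_zero.mp h').resolve_left hd0
      exact hLA 0 this
    · have hLx : L *ᵥ x = -(β • y) := by rw [hx]; simp
      have : L *ᵥ A = (-(β * d) / c) • A := by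
        have h' : c • (L *ᵥ A) = -(β • y) := by rw [← mulVec_smul, ← hc]; exact hLx
        rw [hd, smul_smul] at h'
        have h'' : L *ᵥ A = c⁻¹ • (c • (L *ᵥ A)) := by
          rw [smul_smul, inv_mul_cancel₀ hc0, one_smul]
        rw [h'', h', ← neg_smul, smul_smul]
        congr 1
        field_simp
      exact hLA _ this

/-- `(c • M) *ᵥ v = c • (M *ᵥ v)` (folklore). -/
theorem smul_mulVec_assoc' (c : ℝ) (M : Matrix ι ι ℝ) (v : ι → ℝ) :
    (c • M) *ᵥ v = c • (M *ᵥ v) := by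
  ext i
  simp only [mulVec, dotProduct, Matrix.smul_apply, Pi.smul_apply, smul_eq_mul, Finset.mul_sum, mul_assoc]

variable [DecidableEq ι]

/-- Quadratic form of the reduced linearisation `L = -H - 2·diag(A)·T·diag(A)`. -/
theorem reduced_form (H T : Matrix ι ι ℝ) (A v : ι → ℝ) :
    v ⬝ᵥ ((-H - (2 : ℝ) • (diagonal A * T * diagonal A)) *ᵥ v)
      = -(v ⬝ᵥ (H *ᵥ v)) - 2 * ((fun i => A i * v i) ⬝ᵥ (T *ᵥ fun i => A i * v i)) := by
  have hD : diagonal A *ᵥ v = fun i => A i * v i := by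
    funext i; rw [mulVec_diagonal]
  have key : v ⬝ᵥ ((diagonal A * T * diagonal A) *ᵥ v)
      = (fun i => A i * v i) ⬝ᵥ (T *ᵥ fun i => A i * v i) := by
    rw [← mulVec_mulVec, ← mulVec_mulVec, hD]
    unfold dotProduct
    refine Finset.sum_congr rfl fun i _ => ?_
    rw [mulVec_diagonal]; ring
  rw [sub_mulVec, neg_mulVec, smul_mulVec_assoc', dotProduct_sub, dotProduct_neg, dotProduct_smul,
    key, smul_eq_mul]

/-- **Structural hypotheses ⇒ abstract hypotheses.** With `H ⪰ 0` vanishing (as a form) only on `ℝA`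
and `T` with positive semidefinite symmetric part, the form of `L = -H - 2 diag(A) T diag(A)` is
nonpositive and vanishes only on `ℝA`. -/
theorem reduced_form_nonpos (H T : Matrix ι ι ℝ) (A : ι → ℝ)
    (hH : ∀ v, 0 ≤ v ⬝ᵥ (H *ᵥ v)) (hHker : ∀ v, v ⬝ᵥ (H *ᵥ v) = 0 → ∃ c : ℝ, v = c • A)
    (hT : ∀ u, 0 ≤ u ⬝ᵥ (T *ᵥ u)) :
    (∀ v, v ⬝ᵥ ((-H - (2 : ℝ) • (diagonal A * T * diagonal A)) *ᵥ v) ≤ 0) ∧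
    (∀ v, v ⬝ᵥ ((-H - (2 : ℝ) • (diagonal A * T * diagonal A)) *ᵥ v) = 0 → ∃ c : ℝ, v = c • A) := by
  constructor
  · intro v; rw [reduced_form]
    have := hH v; have := hT (fun i => A i * v i); linarith
  · intro v hv; rw [reduced_form] at hv
    have h1 := hH v; have h2 := hT (fun i => A i * v i)
    exact hHker v (by linarith)

/-- **Pattern stability.** Under the structural hypotheses and `LA ∉ ℝA`, every eigenvalue of the
reduced linearisation has negative real part (real form). -/
theorem pattern_linearly_stable (H T : Matrix ι ι ℝ) (A : ι → ℝ)
    (hH : ∀ v, 0 ≤ v ⬝ᵥ (H *ᵥ v)) (hHker : ∀ v, v ⬝ᵥ (H *ᵥ v) = 0 → ∃ c : ℝ, v = c • A)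
    (hT : ∀ u, 0 ≤ u ⬝ᵥ (T *ᵥ u))
    (hLA : ∀ c : ℝ, (-H - (2 : ℝ) • (diagonal A * T * diagonal A)) *ᵥ A ≠ c • A)
    (x y : ι → ℝ) (α β : ℝ)
    (hx : (-H - (2 : ℝ) • (diagonal A * T * diagonal A)) *ᵥ x = α • x - β • y)
    (hy : (-H - (2 : ℝ) • (diagonal A * T * diagonal A)) *ᵥ y = β • x + α • y)
    (hne : x ≠ 0 ∨ y ≠ 0) : α < 0 := by
  obtain ⟨hL, hker⟩ := reduced_form_nonpos H T A hH hHker hT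
  exact eigen_re_neg_of_form_nonpos _ A hL hker hLA x y α β hx hy hne

end Summit.AnomalousDissipation.AnomalousDissipation.Theorems
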